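import Literature.Probability.RandomPlanarGeometry.HexSAWPolygonCellsRUChain
import Literature.Probability.RandomPlanarGeometry.HexSAWPolygonCellsPortLemmas
import Literature.Probability.RandomPlanarGeometry.HexSAWPolygonCellsChainBase
import Literature.Probability.RandomPlanarGeometry.HexSAWPolygonCellsOmegaRec
import HarnessLib

/-!
# Cell calculus for honeycomb polygon surgery, XXVIII: base data for the RU-family (flip and leaf at the chain hexagon `c_j`) — images, port tables and
# the port invariant

Topic `Literature/Probability/RandomPlanarGeometry` (lane «pcv-sawmu», a-p4 g22; sequel of XXVI `…CellsRUChain`, XXVII `…CellsPortLemmas`, IX `…CellsChainBase`,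
XXII `…CellsOmegaRec` (`PortInv`)).

For the roof-end base `B = B₀ + a_k` (`B₀` of type R at `t₀`, `k ≥ 2`) with chain index `j` and chain hexagon `c = c_j` (THEOREM-OMEGA §2, RU-family):
* FLIP (`L c ∈ B₀`): `ruFlipImage = B + UL c`, ports `c ↦ UR (UL c)`, `d ↦ UR d` otherwise (`ruFlipPort`); ★ `portInv_ruFlip : PortInv ∅ B ruFlipImage ruFlipPort`.
* LEAF (`L c ∉ B₀`): `ruLeafImage = B₀ ∪ roof t₀ k + UL c`, ports `c ↦ UR (UL c)`, `c_i ↦ UL c_i` (`i < j`), `d ↦ UR d` otherwise (`ruLeafPort`);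
  ★ `portInv_ruLeaf : PortInv ∅ B ruLeafImage ruLeafPort`.
(P1),(P2) come from XXVII's `GoodPort` lemmas on the row profile «rows ≤ t₀.y + 1, only `UL c` on the top row»; (P3) from the diagonal bookkeeping
`δ(UR a_k) = δ₀ + 2k`, `δ(UR (UL c_j)) = δ₀ − 4j − 2`, `δ(UL c_i) = δ₀ − 4i − 2`, `δ(UR c_i) = δ₀ − 4i`, left hosts `≤ δ₀ − 4j − 6`, second row `≥ δ₀ + 2k + 4`,
and VIII's `IsHost.sameRow_gap`.  The `+2` laws are IX's `perim_chainFlip` / `perim_chainLeaf`; polygonality is in the sequel.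

Sources: N. Madras, G. Slade, *The Self-Avoiding Walk* (1993), §3.2, proof of Theorem 3.2.3 [MadrasSlade1993]; I. Jensen, J. Phys.: Conf. Ser. 42 (2006) 163
[Jensen2006HoneycombPolygons].  Label (lane): LANE INFRASTRUCTURE for the lane's step-two injection; NEW IN WRITING only as part of the lane result (a-p4 g21).
-/

open Finset

namespace Literature.Probability.RandomPlanarGeometry.SAW

namespace HexCell

/-! ### Images and ports -/

/-- The RU-flip image `B + UL c_j`. [cite: MadrasSlade1993, §3.2 (proof of Theorem 3.2.3)] -/
noncomputable def ruFlipImage (B₀ : Finset Cell) (t₀ : Cell) (k : ℕ) : Finset Cell :=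
  insert (UL (chainCell t₀ (chainIdx B₀ t₀))) (insert (roofCell t₀ (k - 1)) B₀)

/-- The RU-flip port table. [cite: MadrasSlade1993, §3.2 (proof of Theorem 3.2.3)] -/
noncomputable def ruFlipPort (B₀ : Finset Cell) (t₀ : Cell) (d : Cell) : Cell :=
  if d = chainCell t₀ (chainIdx B₀ t₀) then UR (UL d) else UR d

/-- The RU-leaf image `B₀ ∪ roof t₀ k + UL c_j`. [cite: MadrasSlade1993, §3.2 (proof of Theorem 3.2.3)] -/
noncomputable def ruLeafImage (B₀ : Finset Cell) (t₀ : Cell) (k : ℕ) : Finset Cell :=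
  insert (UL (chainCell t₀ (chainIdx B₀ t₀))) (B₀ ∪ roof t₀ k)

/-- The RU-leaf port table. [cite: MadrasSlade1993, §3.2 (proof of Theorem 3.2.3)] -/
noncomputable def ruLeafPort (B₀ : Finset Cell) (t₀ : Cell) (d : Cell) : Cell :=
  if d = chainCell t₀ (chainIdx B₀ t₀) then UR (UL d)
  else if d.2 = t₀.2 ∧ (chainCell t₀ (chainIdx B₀ t₀)).1 < d.1 ∧ d.1 ≤ t₀.1 then UL d else UR d

section RU

variable {B₀ : Finset Cell} {t₀ : Cell} {k : ℕ}

/-- Row profile of the flip image. [cite: MadrasSlade1993, §3.2 (proof of Theorem 3.2.3)] -/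
theorem rowProfile_ruFlipImage (ht : IsLexmax B₀ t₀) :
    RowProfile (ruFlipImage B₀ t₀ k) t₀.2 ((chainCell t₀ (chainIdx B₀ t₀)).1 - 1) := by
  intro x hx
  rcases mem_insert.1 hx with rfl | hx
  · simp
  rcases mem_insert.1 hx with rfl | hx
  · simp
  · rcases ht.2 x hx with h | ⟨h, -⟩
    · exact ⟨by omega, fun e => by omega⟩
    · exact ⟨by omega, fun e => by omega⟩

/-- Row profile of the leaf image. [cite: MadrasSlade1993, §3.2 (proof of Theorem 3.2.3)] -/
theorem rowProfile_ruLeafImage (ht : IsLexmax B₀ t₀) :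
    RowProfile (ruLeafImage B₀ t₀ k) t₀.2 ((chainCell t₀ (chainIdx B₀ t₀)).1 - 1) := by
  intro x hx
  rcases mem_insert.1 hx with rfl | hx
  · simp
  rcases mem_union.1 hx with hx | hx
  · rcases ht.2 x hx with h | ⟨h, -⟩
    · exact ⟨by omega, fun e => by omega⟩
    · exact ⟨by omega, fun e => by omega⟩
  · obtain ⟨i, -, rfl⟩ := mem_roof.1 hx
    simp

/-- Membership in the flip image by coordinates on row `t₀.y`: the top row of `B₀` or `a_k`. [cite: MadrasSlade1993, §3.2 (proof of Theorem 3.2.3)] -/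
theorem mem_ruFlipImage_row {x : Cell} (hx : x ∈ ruFlipImage B₀ t₀ k) (hrow : x.2 = t₀.2) : x ∈ B₀ ∨ x = roofCell t₀ (k - 1) := by
  rcases mem_insert.1 hx with rfl | hx
  · simp at hrow
  rcases mem_insert.1 hx with h | h
  · exact Or.inr h
  · exact Or.inl h

/-- Membership in the leaf image by coordinates on row `t₀.y`: the top row of `B₀` or a roof hexagon (abscissa in `(t₀.x, t₀.x + 2k]`).
[cite: MadrasSlade1993, §3.2 (proof of Theorem 3.2.3)] -/
theorem mem_ruLeafImage_row {x : Cell} (hx : x ∈ ruLeafImage B₀ t₀ k) (hrow : x.2 = t₀.2) :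
    x ∈ B₀ ∨ (t₀.1 < x.1 ∧ x.1 ≤ t₀.1 + 2 * k) := by
  rcases mem_insert.1 hx with rfl | hx
  · simp at hrow
  rcases mem_union.1 hx with h | h
  · exact Or.inl h
  · obtain ⟨i, hi, rfl⟩ := mem_roof.1 h
    right; simp; omega

/-- Row `t₀.y − 1` of either image is the row of `B₀`. [cite: MadrasSlade1993, §3.2 (proof of Theorem 3.2.3)] -/
theorem mem_of_mem_ruFlipImage_lowRow {x : Cell} (hx : x ∈ ruFlipImage B₀ t₀ k) (hrow : x.2 = t₀.2 - 1) : x ∈ B₀ := by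
  rcases mem_insert.1 hx with rfl | hx
  · simp at hrow; omega
  rcases mem_insert.1 hx with rfl | h
  · simp at hrow; omega
  · exact h

/-- [cite: MadrasSlade1993, §3.2 (proof of Theorem 3.2.3)] -/
theorem mem_of_mem_ruLeafImage_lowRow {x : Cell} (hx : x ∈ ruLeafImage B₀ t₀ k) (hrow : x.2 = t₀.2 - 1) : x ∈ B₀ := by
  rcases mem_insert.1 hx with rfl | hx
  · simp at hrow; omega
  rcases mem_union.1 hx with h | h
  · exact h
  · obtain ⟨i, -, rfl⟩ := mem_roof.1 h; simp at hrow; omega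

/-! ### The flip: good ports -/

/-- ★ Every host of `B = B₀ + a_k` has a good port in the flip image. [cite: MadrasSlade1993, §3.2 (proof of Theorem 3.2.3)] -/
theorem goodPort_ruFlip (hB : IsBrickSet B₀) (ht : IsLexmax B₀ t₀) (hk : 2 ≤ k) (hrun : ∀ i < k, runCell t₀ i ∈ B₀) (hend : runCell t₀ k ∉ B₀)
    (hflip : L (chainCell t₀ (chainIdx B₀ t₀)) ∈ B₀) {d : Cell} (hd : IsHost (insert (roofCell t₀ (k - 1)) B₀) d) :
    ∃ q, GoodPort (ruFlipImage B₀ t₀ k) (ruFlipPort B₀ t₀ d) q := by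
  have hprof := rowProfile_ruFlipImage (k := k) ht
  have hcB : chainCell t₀ (chainIdx B₀ t₀) ∈ B₀ := chainCell_mem ht.1 le_rfl
  have hc1 : (chainCell t₀ (chainIdx B₀ t₀)).1 = t₀.1 - 4 * (chainIdx B₀ t₀ : ℤ) := rfl
  rcases (isHost_roofEnd_iff hB ht hk hrun hend).1 hd with rfl | ⟨hd₀, hrow⟩ | ⟨hd₀, hrow, hxd⟩
  · -- the spike `a_k`: port `UR a_k`
    have hne : roofCell t₀ (k - 1) ≠ chainCell t₀ (chainIdx B₀ t₀) := fun e => ht.roofCell_notMem (k - 1) (e ▸ hcB)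
    rw [ruFlipPort, if_neg hne, show roofCell t₀ (k - 1) = ((t₀.1 + 2 * ((k - 1 : ℕ) : ℤ) + 2, t₀.2) : Cell) from rfl]
    refine ⟨_, goodPort_ur_topRow hprof (by exact mem_insert_of_mem (mem_insert_self _ _)) (fun h => ?_) ⟨by omega, by omega, by omega⟩⟩
    rcases mem_ruFlipImage_row h rfl with h | h
    · exact ht.notMem_of_right (by simp) (by simp; omega) h
    · have := congrArg Prod.fst h; simp at this
  · by_cases hdc : d = chainCell t₀ (chainIdx B₀ t₀)
    · -- the chain hexagon: port `UR (UL c)` with contact `UL c`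
      subst hdc
      rw [ruFlipPort, if_pos rfl, show UL (chainCell t₀ (chainIdx B₀ t₀)) = (((chainCell t₀ (chainIdx B₀ t₀)).1 - 1, t₀.2 + 1) : Cell) by ext <;> simp]
      exact ⟨_, goodPort_ur_apex hprof (by
        rw [show (((chainCell t₀ (chainIdx B₀ t₀)).1 - 1, t₀.2 + 1) : Cell) = UL (chainCell t₀ (chainIdx B₀ t₀)) by ext <;> simp]
        exact mem_insert_self _ _)⟩
    · -- other top-row host: port `UR d`
      rw [ruFlipPort, if_neg hdc]
      obtain ⟨x, y⟩ := d
      simp only at hrow; subst hrow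
      have hxle : x ≤ t₀.1 := by rcases ht.2 _ hd₀.1 with h1 | ⟨-, h1⟩ <;> [simp at h1; simpa using h1]
      refine ⟨_, goodPort_ur_topRow hprof (mem_insert_of_mem (mem_insert_of_mem hd₀.1)) (fun h => ?_) ⟨?_, ?_, ?_⟩⟩
      · rcases mem_ruFlipImage_row h rfl with h | h
        · exact hd₀.2.1 h
        · have := congrArg Prod.fst h; simp at this; omega
      · -- `x ≠ c.x`: distinct hexagons on one row
        intro e; apply hdc; exact Prod.ext (by simp only [chainCell_fst]; omega) (by simp)
      · -- `x ≠ c.x − 2`: `L c` is not a host (its right neighbour `c` is present)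
        intro e
        apply hd₀.2.1
        rw [show R (x, t₀.2) = chainCell t₀ (chainIdx B₀ t₀) from Prod.ext (by simp only [R_fst, chainCell_fst]; omega) (by simp)]; exact hcB
      · -- `x ≠ c.x − 4`: `L² c` is not a host (`L c ∈ B₀`)
        intro e
        apply hd₀.2.1
        rw [show R (x, t₀.2) = L (chainCell t₀ (chainIdx B₀ t₀)) from Prod.ext (by simp only [R_fst, L_fst, chainCell_fst]; omega) (by simp)]; exact hflip
  · -- second-row host: port `UR d`
    have hdc : d ≠ chainCell t₀ (chainIdx B₀ t₀) := by
      intro e; rw [e, chainCell_snd] at hrow; omega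
    rw [ruFlipPort, if_neg hdc]
    obtain ⟨x, y⟩ := d
    simp only at hrow hxd; subst hrow
    refine ⟨_, goodPort_ur_secondRow hprof (mem_insert_of_mem (mem_insert_of_mem hd₀.1)) (fun h => hd₀.2.1 (mem_of_mem_ruFlipImage_lowRow h rfl))
      (fun z hz hzrow => ?_) (by omega)⟩
    rcases mem_ruFlipImage_row hz hzrow with h | h
    · rcases ht.2 z h with h1 | ⟨-, h1⟩ <;> omega
    · rw [h]; simp; omega

/-! ### The leaf: good ports -/

/-- ★ Every host of `B = B₀ + a_k` has a good port in the leaf image. [cite: MadrasSlade1993, §3.2 (proof of Theorem 3.2.3)] -/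
theorem goodPort_ruLeaf (hB : IsBrickSet B₀) (ht : IsLexmax B₀ t₀) (hk : 2 ≤ k) (hrun : ∀ i < k, runCell t₀ i ∈ B₀) (hend : runCell t₀ k ∉ B₀)
    {d : Cell} (hd : IsHost (insert (roofCell t₀ (k - 1)) B₀) d) :
    ∃ q, GoodPort (ruLeafImage B₀ t₀ k) (ruLeafPort B₀ t₀ d) q := by
  have hprof := rowProfile_ruLeafImage (k := k) ht
  have hcB : chainCell t₀ (chainIdx B₀ t₀) ∈ B₀ := chainCell_mem ht.1 le_rfl
  have hc1 : (chainCell t₀ (chainIdx B₀ t₀)).1 = t₀.1 - 4 * (chainIdx B₀ t₀ : ℤ) := rfl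
  have hB0sub : B₀ ⊆ ruLeafImage B₀ t₀ k := fun x hx => mem_insert_of_mem (mem_union_left _ hx)
  rcases (isHost_roofEnd_iff hB ht hk hrun hend).1 hd with rfl | ⟨hd₀, hrow⟩ | ⟨hd₀, hrow, hxd⟩
  · -- the spike `a_k`: port `UR a_k`
    have hne : roofCell t₀ (k - 1) ≠ chainCell t₀ (chainIdx B₀ t₀) := fun e => ht.roofCell_notMem (k - 1) (e ▸ hcB)
    have hnot2 : ¬ ((roofCell t₀ (k - 1)).2 = t₀.2 ∧ (chainCell t₀ (chainIdx B₀ t₀)).1 < (roofCell t₀ (k - 1)).1 ∧ (roofCell t₀ (k - 1)).1 ≤ t₀.1) := by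
      simp only [roofCell_fst, roofCell_snd]; omega
    rw [ruLeafPort, if_neg hne, if_neg hnot2, show roofCell t₀ (k - 1) = ((t₀.1 + 2 * ((k - 1 : ℕ) : ℤ) + 2, t₀.2) : Cell) from rfl]
    refine ⟨_, goodPort_ur_topRow hprof ?_ (fun h => ?_) ⟨by omega, by omega, by omega⟩⟩
    · exact mem_insert_of_mem (mem_union_right _ (mem_roof.2 ⟨k - 1, by omega, rfl⟩))
    · rcases mem_ruLeafImage_row h rfl with h | h
      · exact ht.notMem_of_right (by simp) (by simp; omega) h
      · simp at h; omega
  · by_cases hdc : d = chainCell t₀ (chainIdx B₀ t₀)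
    · subst hdc
      rw [ruLeafPort, if_pos rfl, show UL (chainCell t₀ (chainIdx B₀ t₀)) = (((chainCell t₀ (chainIdx B₀ t₀)).1 - 1, t₀.2 + 1) : Cell) by ext <;> simp]
      exact ⟨_, goodPort_ur_apex hprof (by
        rw [show (((chainCell t₀ (chainIdx B₀ t₀)).1 - 1, t₀.2 + 1) : Cell) = UL (chainCell t₀ (chainIdx B₀ t₀)) by ext <;> simp]
        exact mem_insert_self _ _)⟩
    · obtain ⟨x, y⟩ := d
      simp only at hrow; subst hrow
      have hxle : x ≤ t₀.1 := by rcases ht.2 _ hd₀.1 with h1 | ⟨-, h1⟩ <;> [simp at h1; simpa using h1]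
      by_cases hright : (chainCell t₀ (chainIdx B₀ t₀)).1 < x
      · -- a chain hexagon `c_i`, `i < j`: port `UL c_i`
        obtain ⟨i, hij, hi⟩ := mem_topRow_right_of_chain hB ht hd₀.1 rfl hright
        have hx : x = t₀.1 - 4 * (i : ℤ) := by have := congrArg Prod.fst hi; simpa using this
        rw [ruLeafPort, if_neg hdc, if_pos ⟨rfl, hright, hxle⟩]
        refine ⟨_, goodPort_ul_topRow hprof (hB0sub hd₀.1) (fun h => ?_) ⟨by omega, by omega, by omega⟩⟩
        rcases mem_ruLeafImage_row h rfl with h | h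
        · have := (not_chainStop_of_lt hij).1
          rw [← hi, show L (x, t₀.2) = ((x - 2, t₀.2) : Cell) by ext <;> simp] at this
          exact this h
        · simp at h; omega
      · -- a top-row host left of `c_j`: port `UR d`
        have hlt : x < (chainCell t₀ (chainIdx B₀ t₀)).1 := by
          rcases lt_or_eq_of_le (not_lt.1 hright) with h | h
          · exact h
          · exfalso; apply hdc; exact Prod.ext h rfl
        have hfar := topRow_host_left_le hB ht hd₀ rfl hlt
        rw [ruLeafPort, if_neg hdc, if_neg (by rintro ⟨-, h, -⟩; omega)]
        refine ⟨_, goodPort_ur_topRow hprof (hB0sub hd₀.1) (fun h => ?_) ⟨by omega, by omega, by omega⟩⟩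
        rcases mem_ruLeafImage_row h rfl with h | h
        · exact hd₀.2.1 h
        · simp at h; omega
  · -- second-row host: port `UR d`
    have hdc : d ≠ chainCell t₀ (chainIdx B₀ t₀) := by
      intro e; rw [e, chainCell_snd] at hrow; omega
    rw [ruLeafPort, if_neg hdc, if_neg (by rintro ⟨h, -⟩; omega)]
    obtain ⟨x, y⟩ := d
    simp only at hrow hxd; subst hrow
    refine ⟨_, goodPort_ur_secondRow hprof (hB0sub hd₀.1) (fun h => hd₀.2.1 (mem_of_mem_ruLeafImage_lowRow h rfl)) (fun z hz hzrow => ?_) (by omega)⟩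
    rcases mem_ruLeafImage_row hz hzrow with h | h
    · rcases ht.2 z h with h1 | ⟨-, h1⟩ <;> omega
    · omega

/-! ### Diagonal separation (P3) -/

/-- Diagonal of the flip ports. [cite: MadrasSlade1993, §3.2 (proof of Theorem 3.2.3)] -/
theorem diag_ruFlipPort (d : Cell) :
    diag (ruFlipPort B₀ t₀ d) = if d = chainCell t₀ (chainIdx B₀ t₀) then diag d - 2 else diag d := by
  unfold ruFlipPort; split_ifs <;> simp

/-- Diagonal of the leaf ports. [cite: MadrasSlade1993, §3.2 (proof of Theorem 3.2.3)] -/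
theorem diag_ruLeafPort (d : Cell) :
    diag (ruLeafPort B₀ t₀ d) =
      if d = chainCell t₀ (chainIdx B₀ t₀) ∨ (d.2 = t₀.2 ∧ (chainCell t₀ (chainIdx B₀ t₀)).1 < d.1 ∧ d.1 ≤ t₀.1) then diag d - 2 else diag d := by
  unfold ruLeafPort
  by_cases h1 : d = chainCell t₀ (chainIdx B₀ t₀)
  · rw [if_pos h1, if_pos (Or.inl h1)]; simp
  · rw [if_neg h1]
    by_cases h2 : d.2 = t₀.2 ∧ (chainCell t₀ (chainIdx B₀ t₀)).1 < d.1 ∧ d.1 ≤ t₀.1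
    · rw [if_pos h2, if_pos (Or.inr h2)]; simp
    · rw [if_neg h2, if_neg (not_or.2 ⟨h1, h2⟩)]; simp

/-- ★ (P3) for the flip. [cite: MadrasSlade1993, §3.2 (proof of Theorem 3.2.3)] -/
theorem sep_ruFlip (hB : IsBrickSet B₀) (ht : IsLexmax B₀ t₀) (hk : 2 ≤ k) (hrun : ∀ i < k, runCell t₀ i ∈ B₀) (hend : runCell t₀ k ∉ B₀)
    {h h' : Cell} (hh : IsHost (insert (roofCell t₀ (k - 1)) B₀) h) (hh' : IsHost (insert (roofCell t₀ (k - 1)) B₀) h') (hne : h ≠ h') :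
    4 ≤ |diag (ruFlipPort B₀ t₀ h) - diag (ruFlipPort B₀ t₀ h')| := by
  have hgap := hosts_diag_gap_roofEnd hB ht hk hrun hend hh hh' hne
  have hcB : chainCell t₀ (chainIdx B₀ t₀) ∈ B₀ := chainCell_mem ht.1 le_rfl
  have hc1 : (chainCell t₀ (chainIdx B₀ t₀)).1 = t₀.1 - 4 * (chainIdx B₀ t₀ : ℤ) := rfl
  have hk1 : (1 : ℤ) ≤ ((k - 1 : ℕ) : ℤ) := by exact_mod_cast (show 1 ≤ k - 1 by omega)
  -- the mixed case: `u = c_j`, `v ≠ c_j`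
  have key : ∀ {v : Cell}, IsHost (insert (roofCell t₀ (k - 1)) B₀) v → v ≠ chainCell t₀ (chainIdx B₀ t₀) →
      4 ≤ |diag (chainCell t₀ (chainIdx B₀ t₀)) - 2 - diag v| := by
    intro v hv hvc
    rw [le_abs]; simp only [diag, chainCell_fst, chainCell_snd]
    rcases (isHost_roofEnd_iff hB ht hk hrun hend).1 hv with rfl | ⟨hd, hrow⟩ | ⟨hd, hrow, hx⟩
    · simp only [roofCell_fst, roofCell_snd]; omega
    · rcases topRow_host_dichotomy hB ht hd hrow hvc with ⟨i, hi, rfl⟩ | hfar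
      · simp only [chainCell_fst, chainCell_snd]; omega
      · rw [hc1] at hfar; omega
    · omega
  rw [diag_ruFlipPort, diag_ruFlipPort]
  by_cases h1 : h = chainCell t₀ (chainIdx B₀ t₀)
  · have h2 : h' ≠ chainCell t₀ (chainIdx B₀ t₀) := fun e => hne (h1.trans e.symm)
    rw [if_pos h1, if_neg h2, h1]; exact key hh' h2
  · by_cases h2 : h' = chainCell t₀ (chainIdx B₀ t₀)
    · rw [if_neg h1, if_pos h2, h2, abs_sub_comm]; exact key hh h1
    · rw [if_neg h1, if_neg h2]; exact hgap

/-- ★ (P3) for the leaf. [cite: MadrasSlade1993, §3.2 (proof of Theorem 3.2.3)] -/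
theorem sep_ruLeaf (hB : IsBrickSet B₀) (ht : IsLexmax B₀ t₀) (hk : 2 ≤ k) (hrun : ∀ i < k, runCell t₀ i ∈ B₀) (hend : runCell t₀ k ∉ B₀)
    {h h' : Cell} (hh : IsHost (insert (roofCell t₀ (k - 1)) B₀) h) (hh' : IsHost (insert (roofCell t₀ (k - 1)) B₀) h') (hne : h ≠ h') :
    4 ≤ |diag (ruLeafPort B₀ t₀ h) - diag (ruLeafPort B₀ t₀ h')| := by
  have hgap := hosts_diag_gap_roofEnd hB ht hk hrun hend hh hh' hne
  have hcB : chainCell t₀ (chainIdx B₀ t₀) ∈ B₀ := chainCell_mem ht.1 le_rfl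
  have hc1 : (chainCell t₀ (chainIdx B₀ t₀)).1 = t₀.1 - 4 * (chainIdx B₀ t₀ : ℤ) := rfl
  have hk1 : (1 : ℤ) ≤ ((k - 1 : ℕ) : ℤ) := by exact_mod_cast (show 1 ≤ k - 1 by omega)
  -- shifted class: `c_j` and the top-row hosts right of it; such a host has `c.x ≤ x ≤ t₀.x` on row `t₀.y`
  have shifted : ∀ {v : Cell}, IsHost (insert (roofCell t₀ (k - 1)) B₀) v →
      (v = chainCell t₀ (chainIdx B₀ t₀) ∨ (v.2 = t₀.2 ∧ (chainCell t₀ (chainIdx B₀ t₀)).1 < v.1 ∧ v.1 ≤ t₀.1)) →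
      v.2 = t₀.2 ∧ (chainCell t₀ (chainIdx B₀ t₀)).1 ≤ v.1 ∧ v.1 ≤ t₀.1 := by
    intro v hv hcls
    rcases hcls with rfl | ⟨h1, h2, h3⟩
    · refine ⟨rfl, le_rfl, ?_⟩; rcases ht.2 _ hcB with e | ⟨-, e⟩ <;> [simp at e; exact e]
    · exact ⟨h1, h2.le, h3⟩
  -- plain class vs shifted class
  have mixed : ∀ {u v : Cell}, IsHost (insert (roofCell t₀ (k - 1)) B₀) u → IsHost (insert (roofCell t₀ (k - 1)) B₀) v →
      (u = chainCell t₀ (chainIdx B₀ t₀) ∨ (u.2 = t₀.2 ∧ (chainCell t₀ (chainIdx B₀ t₀)).1 < u.1 ∧ u.1 ≤ t₀.1)) →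
      ¬ (v = chainCell t₀ (chainIdx B₀ t₀) ∨ (v.2 = t₀.2 ∧ (chainCell t₀ (chainIdx B₀ t₀)).1 < v.1 ∧ v.1 ≤ t₀.1)) →
      4 ≤ |diag u - 2 - diag v| := by
    intro u v hu hv hucls hvcls
    obtain ⟨hu2, hu1, hu3⟩ := shifted hu hucls
    rw [not_or] at hvcls
    rw [le_abs]; simp only [diag]
    rcases (isHost_roofEnd_iff hB ht hk hrun hend).1 hv with rfl | ⟨hd, hrow⟩ | ⟨hd, hrow, hx⟩
    · simp only [roofCell_fst, roofCell_snd]; omega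
    · -- a plain top-row host is left of `c_j`
      have hvx : v.1 ≤ t₀.1 := by rcases ht.2 _ hd.1 with e | ⟨-, e⟩ <;> omega
      have hlt : v.1 < (chainCell t₀ (chainIdx B₀ t₀)).1 := by
        by_contra hge
        rcases lt_or_eq_of_le (not_lt.1 hge) with hgt | heq
        · exact hvcls.2 ⟨hrow, hgt, hvx⟩
        · exact hvcls.1 (Prod.ext heq.symm (by rw [hrow, chainCell_snd]))
      have hfar := topRow_host_left_le hB ht hd hrow hlt
      omega
    · omega
  rw [diag_ruLeafPort, diag_ruLeafPort]
  split_ifs with h1 h2 h2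
  · rw [show diag h - 2 - (diag h' - 2) = diag h - diag h' by ring]; exact hgap
  · exact mixed hh hh' h1 h2
  · rw [abs_sub_comm, show diag h' - 2 - diag h = diag h' - 2 - diag h from rfl]; exact mixed hh' hh h2 h1
  · exact hgap

/-! ### The port invariants -/

/-- Bricks: the roof-end base. [cite: EntingJensen2009, §7.4.2] -/
theorem isBrickSet_roofEnd (hB : IsBrickSet B₀) (ht : IsLexmax B₀ t₀) : IsBrickSet (insert (roofCell t₀ (k - 1)) B₀) := by
  intro x hx
  rcases mem_insert.1 hx with rfl | hx
  · have := hB _ ht.1; rw [Int.even_iff] at this ⊢; simp; omega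
  · exact hB x hx

/-- ★ **Port invariant of the RU flip.** [cite: MadrasSlade1993, §3.2 (proof of Theorem 3.2.3)] -/
theorem portInv_ruFlip (hB : IsBrickSet B₀) (ht : IsLexmax B₀ t₀) (hk : 2 ≤ k) (hrun : ∀ i < k, runCell t₀ i ∈ B₀) (hend : runCell t₀ k ∉ B₀)
    (hflip : L (chainCell t₀ (chainIdx B₀ t₀)) ∈ B₀) :
    PortInv ∅ (insert (roofCell t₀ (k - 1)) B₀) (ruFlipImage B₀ t₀ k) (ruFlipPort B₀ t₀) := by
  have hBb := isBrickSet_roofEnd (k := k) hB ht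
  have hcb := hB _ (chainCell_mem ht.1 (le_refl (chainIdx B₀ t₀)))
  refine ⟨hBb, ?_, ?_, ?_, ?_, ?_, ?_⟩
  · intro x hx
    rcases mem_insert.1 hx with rfl | hx
    · rw [Int.even_iff] at hcb ⊢; simp only [UL_fst, UL_snd, chainCell_fst, chainCell_snd] at hcb ⊢; omega
    · exact hBb x hx
  · intro h hh _
    have := hBb h hh.1
    rw [ruFlipPort]; split_ifs <;> (rw [Int.even_iff] at this ⊢; simp; omega)
  · intro h hh _ j; obtain ⟨q, hq⟩ := goodPort_ruFlip hB ht hk hrun hend hflip hh; exact hq.urIter_notMem j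
  · intro h hh _; obtain ⟨q, hq⟩ := goodPort_ruFlip hB ht hk hrun hend hflip hh; exact hq.card_contacts
  · intro h hh _ j hj x hx; obtain ⟨q, hq⟩ := goodPort_ruFlip hB ht hk hrun hend hflip hh; exact hq.clear j hj x hx
  · intro h h' hh _ hh' _ hne; exact sep_ruFlip hB ht hk hrun hend hh hh' hne

/-- ★ **Port invariant of the RU leaf.** [cite: MadrasSlade1993, §3.2 (proof of Theorem 3.2.3)] -/
theorem portInv_ruLeaf (hB : IsBrickSet B₀) (ht : IsLexmax B₀ t₀) (hk : 2 ≤ k) (hrun : ∀ i < k, runCell t₀ i ∈ B₀) (hend : runCell t₀ k ∉ B₀) :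
    PortInv ∅ (insert (roofCell t₀ (k - 1)) B₀) (ruLeafImage B₀ t₀ k) (ruLeafPort B₀ t₀) := by
  have hBb := isBrickSet_roofEnd (k := k) hB ht
  have htb := hB _ ht.1
  have hcb := hB _ (chainCell_mem ht.1 (le_refl (chainIdx B₀ t₀)))
  refine ⟨hBb, ?_, ?_, ?_, ?_, ?_, ?_⟩
  · intro x hx
    rcases mem_insert.1 hx with rfl | hx
    · rw [Int.even_iff] at hcb ⊢; simp only [UL_fst, UL_snd, chainCell_fst, chainCell_snd] at hcb ⊢; omega
    · rcases mem_union.1 hx with hx | hx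
      · exact hB x hx
      · obtain ⟨i, -, rfl⟩ := mem_roof.1 hx
        rw [Int.even_iff] at htb ⊢; simp; omega
  · intro h hh _
    have := hBb h hh.1
    rw [ruLeafPort]; split_ifs <;> (rw [Int.even_iff] at this ⊢; simp; omega)
  · intro h hh _ j; obtain ⟨q, hq⟩ := goodPort_ruLeaf hB ht hk hrun hend hh; exact hq.urIter_notMem j
  · intro h hh _; obtain ⟨q, hq⟩ := goodPort_ruLeaf hB ht hk hrun hend hh; exact hq.card_contacts
  · intro h hh _ j hj x hx; obtain ⟨q, hq⟩ := goodPort_ruLeaf hB ht hk hrun hend hh; exact hq.clear j hj x hx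
  · intro h h' hh _ hh' _ hne; exact sep_ruLeaf hB ht hk hrun hend hh hh' hne

/-- The `+2` law of the RU flip (part IX). [cite: MadrasSlade1993, §3.2, Theorem 3.2.3 (3.2.3)] -/
theorem perim_ruFlipImage (ht : IsLexmax B₀ t₀) (hflip : L (chainCell t₀ (chainIdx B₀ t₀)) ∈ B₀) :
    perim (ruFlipImage B₀ t₀ k) = perim (insert (roofCell t₀ (k - 1)) B₀) + 2 :=
  perim_chainFlip ht k (chainCell_mem ht.1 le_rfl) rfl hflip

/-- The `+2` law of the RU leaf (part IX). [cite: MadrasSlade1993, §3.2, Theorem 3.2.3 (3.2.3)] -/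
theorem perim_ruLeafImage (ht : IsLexmax B₀ t₀) (hk : 2 ≤ k) (hrun : ∀ i < k, runCell t₀ i ∈ B₀) (hend : runCell t₀ k ∉ B₀)
    (hleaf : L (chainCell t₀ (chainIdx B₀ t₀)) ∉ B₀) :
    perim (ruLeafImage B₀ t₀ k) = perim (insert (roofCell t₀ (k - 1)) B₀) + 2 :=
  perim_chainLeaf ht hk hrun hend (chainCell_mem ht.1 le_rfl) rfl hleaf

end RU

end HexCell

end Literature.Probability.RandomPlanarGeometry.SAW
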